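import Mathlib.GroupTheory.Coset.Basic
import Mathlib.GroupTheory.GroupAction.Quotient
import Mathlib.SetTheory.Cardinal.Finite
import Mathlib.Algebra.BigOperators.Group.Finset.Basic
import Mathlib.Tactic.Group
import HarnessLib

/-!
# Fixed points along the fibration `G ⧸ I → G ⧸ K` (`I ≤ K`): `#Fix_γ(G ⧸ I) = Σ_{x ∈ Fix_γ(G ⧸ K)} #Fix_{k_x}(K ⧸ I)`, `k_x = r(x)⁻¹ γ r(x) ∈ K`
(Kottwitz 1988 §2: the edge count of the Euler–Poincaré function fibres over the vertex count; Serre, *Trees*, I §6)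

Topic `NumberTheory/Automorphic`; namespace `Literature.NumberTheory.Automorphic`.  THEOREMS ONLY (no definition, no instance, no notation, no named fact, no `sorry`); pure group
theory over Mathlib's `Subgroup.quotientEquivProdOfLE'`.  Cell `pub/hodgecm-mathlib` (D-0151), crux H413 = `stmt-HodgeConjecture-24833`, line «N6nsGerm», stub
`stub_N6nsR2EP : RankOneEulerPoincareNonsplit` ((R2), Kottwitz's EP function on `U(Φ₂)_v`); LEAD F0P3a-plan (g9) WORD T8-167 (B-p04 = EP pen), BRICK (2a) of the EDGE COUNT
(census `B-provers/B-p04/g34/CENSUS-R2EP-RankOneEulerPoincare.B-p04g34.md`, bus 08:08Z); seat B-p04 (g34).  HONEST LABEL: HC_CM is proved only modulo the printed citations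
until rung 0 closes; nothing printed is asserted here.

THE MATHEMATICS.  `I ≤ K ≤ G`, `γ ∈ G`, `r : G ⧸ K → G` a section (`r(x)K = x`).  Mathlib's `e := quotientEquivProdOfLE' : G ⧸ I ≃ (G ⧸ K) × (K ⧸ I_K)`, `e(gI) = (gK, [r(gK)⁻¹ g])`,
is compatible with the projection (`(e y).1 = π y`, so `(e(γ·y)).1 = γ·(e y).1`) and, over a `γ`-FIXED `x = r(x)K`, turns `γ` into the local monodromy `k_x := r(x)⁻¹ γ r(x) ∈ K`
on the fibre: `(e(γ·y)).2 = k_x · (e y).2` whenever `π y = x`.  Hence the fibre of `Fix_γ(G ⧸ I) → Fix_γ(G ⧸ K)` over `x` is `Fix_{k_x}(K ⧸ I_K)` and, all sets finite,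
**`Nat.card Fix_γ(G ⧸ I) = Σ_{x ∈ Fix_γ(G ⧸ K)} Nat.card Fix_{k_x}(K ⧸ I_K)`** (`natCard_fixedBy_quotient_eq_sum_of_le`).  Applied with `G = U(Φ₂)_v`, `K` a vertex
stabiliser, `I` the Iwahori: the `γ`-fixed EDGES are counted over the `γ`-fixed vertices by the fixed points of `k_x` on the star `K ⧸ I`.

References: [Kottwitz1988] R. E. Kottwitz, *Tamagawa numbers*, Ann. of Math. 127 (1988), §2 · [Serre1980Trees] J.-P. Serre, *Trees* (1980), I §6.
-/

set_option autoImplicit false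

namespace Literature.NumberTheory.Automorphic

open MulAction

section Fibration

variable {G : Type*} [Group G] {I K : Subgroup G} (hIK : I ≤ K) (r : G ⧸ K → G) (hr : Function.RightInverse r QuotientGroup.mk) (γ : G)

include hr in
/-- Over a `γ`-fixed coset `x = r(x)K` the local monodromy `k_x := r(x)⁻¹ γ r(x)` lies in `K`. [cite: Serre1980Trees, I §6] -/
theorem inv_mul_mul_mem_of_smul_eq {x : G ⧸ K} (hx : γ • x = x) : (r x)⁻¹ * γ * r x ∈ K := by
  have h2 : γ • (QuotientGroup.mk (r x) : G ⧸ K) = QuotientGroup.mk (γ * r x) := MulAction.Quotient.smul_mk K γ (r x)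
  rw [hr x, hx] at h2
  have h1 : (QuotientGroup.mk (r x) : G ⧸ K) = QuotientGroup.mk (γ * r x) := by rw [← h2, hr x]
  rw [mul_assoc]
  exact QuotientGroup.eq.1 h1

/-- `e := quotientEquivProdOfLE'` commutes with the projection: `(e(gI)).1 = gK`. [cite: Serre1980Trees, I §6] -/
theorem quotientEquivProdOfLE'_mk_fst (g : G) :
    (Subgroup.quotientEquivProdOfLE' hIK r hr (QuotientGroup.mk g : G ⧸ I)).1 = (QuotientGroup.mk g : G ⧸ K) := rfl

/-- EQUIVARIANCE of the first coordinate: `(e(γ · y)).1 = γ · (e y).1`. [cite: Serre1980Trees, I §6] -/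
theorem quotientEquivProdOfLE'_smul_fst (y : G ⧸ I) :
    (Subgroup.quotientEquivProdOfLE' hIK r hr (γ • y)).1 = γ • (Subgroup.quotientEquivProdOfLE' hIK r hr y).1 := by
  induction y using QuotientGroup.induction_on with
  | H g =>
    rw [MulAction.Quotient.smul_mk, smul_eq_mul, quotientEquivProdOfLE'_mk_fst, quotientEquivProdOfLE'_mk_fst, MulAction.Quotient.smul_mk, smul_eq_mul]

/-- LOCAL MONODROMY on the fibre: if `(e y).1 = x` is `γ`-fixed then `(e(γ · y)).2 = k_x · (e y).2` with `k_x = r(x)⁻¹ γ r(x)`. [cite: Serre1980Trees, I §6] [cite: Kottwitz1988, §2] -/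
theorem quotientEquivProdOfLE'_smul_snd (y : G ⧸ I) (hx : γ • (Subgroup.quotientEquivProdOfLE' hIK r hr y).1 = (Subgroup.quotientEquivProdOfLE' hIK r hr y).1) :
    (Subgroup.quotientEquivProdOfLE' hIK r hr (γ • y)).2 =
      (⟨(r (Subgroup.quotientEquivProdOfLE' hIK r hr y).1)⁻¹ * γ * r (Subgroup.quotientEquivProdOfLE' hIK r hr y).1, inv_mul_mul_mem_of_smul_eq r hr γ hx⟩ : K) •
        (Subgroup.quotientEquivProdOfLE' hIK r hr y).2 := by
  induction y using QuotientGroup.induction_on with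
  | H g =>
    have hx' : (QuotientGroup.mk (γ * g) : G ⧸ K) = QuotientGroup.mk g := by
      rw [quotientEquivProdOfLE'_mk_fst, MulAction.Quotient.smul_mk, smul_eq_mul] at hx; exact hx
    have hrr : r (QuotientGroup.mk (γ * g) : G ⧸ K) = r (QuotientGroup.mk g) := by rw [hx']
    -- both sides are images of elements of `K` with the same underlying element of `G`
    have key : ∀ (a b : K), (a : G) = b → (QuotientGroup.mk a : K ⧸ I.subgroupOf K) = QuotientGroup.mk b := fun a b h => by rw [Subtype.ext h]
    rw [MulAction.Quotient.smul_mk, smul_eq_mul]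
    show (QuotientGroup.mk _ : K ⧸ I.subgroupOf K) = _ • (QuotientGroup.mk _ : K ⧸ I.subgroupOf K)
    rw [MulAction.Quotient.smul_mk, smul_eq_mul]
    refine key _ _ ?_
    show (r (QuotientGroup.mk (γ * g) : G ⧸ K))⁻¹ * (γ * g) = (r (QuotientGroup.mk g : G ⧸ K))⁻¹ * γ * r (QuotientGroup.mk g : G ⧸ K) * ((r (QuotientGroup.mk g : G ⧸ K))⁻¹ * g)
    rw [hrr]; group

/-- **THE FIBRE OVER A FIXED VERTEX**: for `x ∈ Fix_γ(G ⧸ K)`, the `γ`-fixed points of `G ⧸ I` over `x` are in bijection with `Fix_{k_x}(K ⧸ I_K)`, `k_x = r(x)⁻¹ γ r(x)`.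
[cite: Kottwitz1988, §2] [cite: Serre1980Trees, I §6] -/
theorem exists_equiv_fiber_fixedBy_quotient (x : fixedBy (G ⧸ K) γ) :
    Nonempty ({y : fixedBy (G ⧸ I) γ // (Subgroup.quotientEquivProdOfLE' hIK r hr y.1).1 = x.1} ≃
      fixedBy (K ⧸ I.subgroupOf K) (⟨(r x.1)⁻¹ * γ * r x.1, inv_mul_mul_mem_of_smul_eq r hr γ x.2⟩ : K)) := by
  classical
  set e := Subgroup.quotientEquivProdOfLE' hIK r hr with he
  refine ⟨{ toFun := fun y => ⟨(e y.1.1).2, ?_⟩, invFun := fun c => ⟨⟨e.symm (x.1, c.1), ?_⟩, ?_⟩, left_inv := ?_, right_inv := ?_ }⟩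
  · -- fixedness on the fibre
    have hyx : (e y.1.1).1 = x.1 := y.2
    have hfix : γ • (e y.1.1).1 = (e y.1.1).1 := by rw [hyx]; exact x.2
    have h := quotientEquivProdOfLE'_smul_snd hIK r hr γ y.1.1 hfix
    rw [show γ • y.1.1 = y.1.1 from y.1.2] at h
    rw [MulAction.mem_fixedBy]
    have hk : (⟨(r x.1)⁻¹ * γ * r x.1, inv_mul_mul_mem_of_smul_eq r hr γ x.2⟩ : K) =
        ⟨(r (e y.1.1).1)⁻¹ * γ * r (e y.1.1).1, inv_mul_mul_mem_of_smul_eq r hr γ hfix⟩ := by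
      apply Subtype.ext
      show (r x.1)⁻¹ * γ * r x.1 = (r (e y.1.1).1)⁻¹ * γ * r (e y.1.1).1
      rw [hyx]
    rw [hk]; exact h.symm
  · -- the preimage is `γ`-fixed
    rw [MulAction.mem_fixedBy]
    apply e.injective
    have h1 : (e (γ • e.symm (x.1, c.1))).1 = x.1 := by rw [quotientEquivProdOfLE'_smul_fst, e.apply_symm_apply]; exact x.2
    have hfix : γ • (e (e.symm (x.1, c.1))).1 = (e (e.symm (x.1, c.1))).1 := by rw [e.apply_symm_apply]; exact x.2
    have h2 := quotientEquivProdOfLE'_smul_snd hIK r hr γ (e.symm (x.1, c.1)) hfix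
    have hk : (⟨(r (e (e.symm (x.1, c.1))).1)⁻¹ * γ * r (e (e.symm (x.1, c.1))).1, inv_mul_mul_mem_of_smul_eq r hr γ hfix⟩ : K) =
        ⟨(r x.1)⁻¹ * γ * r x.1, inv_mul_mul_mem_of_smul_eq r hr γ x.2⟩ := by
      apply Subtype.ext
      show (r (e (e.symm (x.1, c.1))).1)⁻¹ * γ * r (e (e.symm (x.1, c.1))).1 = (r x.1)⁻¹ * γ * r x.1
      rw [e.apply_symm_apply]
    rw [hk, e.apply_symm_apply] at h2
    have h3 : (e (γ • e.symm (x.1, c.1))).2 = c.1 := by rw [h2]; exact c.2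
    rw [Prod.ext_iff]
    exact ⟨by rw [h1, e.apply_symm_apply], by rw [h3, e.apply_symm_apply]⟩
  · show (e (e.symm (x.1, c.1))).1 = x.1
    rw [e.apply_symm_apply]
  · intro y
    apply Subtype.ext; apply Subtype.ext
    show e.symm (x.1, (e y.1.1).2) = y.1.1
    have : (x.1, (e y.1.1).2) = e y.1.1 := Prod.ext y.2.symm rfl
    rw [this, e.symm_apply_apply]
  · intro c
    apply Subtype.ext
    show (e (e.symm (x.1, c.1))).2 = c.1
    rw [e.apply_symm_apply]

include hIK in
/-- **`#Fix_γ(G ⧸ I) = Σ_{x ∈ Fix_γ(G ⧸ K)} #Fix_{k_x}(K ⧸ I_K)`** for `I ≤ K`, any section `r` of `G → G ⧸ K`, when the `γ`-fixed set of `G ⧸ K` and the fibres are finite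
(the EDGE count of the Euler–Poincaré function over the VERTEX count). [cite: Kottwitz1988, §2 Theorem 2] [cite: Serre1980Trees, I §6] -/
theorem natCard_fixedBy_quotient_eq_sum_of_le [Fintype (fixedBy (G ⧸ K) γ)]
    [∀ x : fixedBy (G ⧸ K) γ, Finite (fixedBy (K ⧸ I.subgroupOf K) (⟨(r x.1)⁻¹ * γ * r x.1, inv_mul_mul_mem_of_smul_eq r hr γ x.2⟩ : K))] :
    Nat.card (fixedBy (G ⧸ I) γ) =
      ∑ x : fixedBy (G ⧸ K) γ, Nat.card (fixedBy (K ⧸ I.subgroupOf K) (⟨(r x.1)⁻¹ * γ * r x.1, inv_mul_mul_mem_of_smul_eq r hr γ x.2⟩ : K)) := by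
  classical
  -- the projection `Fix_γ(G ⧸ I) → Fix_γ(G ⧸ K)`
  let p : fixedBy (G ⧸ I) γ → fixedBy (G ⧸ K) γ := fun y =>
    ⟨(Subgroup.quotientEquivProdOfLE' hIK r hr y.1).1, by
      rw [MulAction.mem_fixedBy, ← quotientEquivProdOfLE'_smul_fst, show γ • y.1 = y.1 from y.2]⟩
  have hF : ∀ x : fixedBy (G ⧸ K) γ, Nonempty ({y // p y = x} ≃
      fixedBy (K ⧸ I.subgroupOf K) (⟨(r x.1)⁻¹ * γ * r x.1, inv_mul_mul_mem_of_smul_eq r hr γ x.2⟩ : K)) := fun x => by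
    obtain ⟨F⟩ := exists_equiv_fiber_fixedBy_quotient hIK r hr γ x
    have e1 : {y // p y = x} ≃ {y : fixedBy (G ⧸ I) γ // (Subgroup.quotientEquivProdOfLE' hIK r hr y.1).1 = x.1} :=
      Equiv.subtypeEquivRight fun y => by rw [Subtype.ext_iff]
    exact ⟨e1.trans F⟩
  haveI : ∀ x : fixedBy (G ⧸ K) γ, Finite {y // p y = x} := fun x => by
    obtain ⟨F⟩ := hF x
    exact Finite.of_equiv _ F.symm
  rw [← Nat.card_congr (Equiv.sigmaFiberEquiv p), Nat.card_sigma]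
  exact Finset.sum_congr rfl fun x _ => by obtain ⟨F⟩ := hF x; exact Nat.card_congr F

end Fibration

end Literature.NumberTheory.Automorphic
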